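import Summits.BirchSwinnertonDyer.Rank1Residual.Additive.KatoDescentKummerUnramifiedCountTamagawa
import Summits.BirchSwinnertonDyer.Rank1Residual.Additive.UnramifiedKummerDoorGeneric
import Summits.BirchSwinnertonDyer.Rank1Residual.X11b.PrimaryInclusionLevels
import Summits.BirchSwinnertonDyer.Rank1Residual.X11b.KummerLocalTorsionSaturation
import Summits.BirchSwinnertonDyer.Rank1Residual.GaloisImage.KummerSelfDualCount
import Literature.NumberTheory.EllipticCurves.SubgroupSelmerProofs
import Literature.NumberTheory.EllipticCurves.DiscreteH1Equiv
import Literature.NumberTheory.EllipticCurves.IwasawaTowerTorsionProofs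
import Literature.NumberTheory.EllipticCurves.PointDivisibilityProofs
import HarnessLib

set_option autoImplicit false

/-!
# (R1-d), THE PASSAGE `k → ∞` ON THE DISCRETE SIDE: along `ι_k : H¹(K, E[p^k]) → H¹(K, E[p^∞])`,
# `Sel^{(p^k)}(E/K) = ι_k⁻¹ Sel_{p^∞}(E/K)`, `H¹_{𝓚 ⊔ ur@Σ}(K, E[p^k]) = ι_k⁻¹ S_Σ(E/K)` (`S_Σ` = Kato's `S(T)`: the `p^∞`-Selmer
# condition off `Σ`, UNRAMIFIED at `Σ`), hence `[H¹_{𝓚⊔ur@Σ}(K,E[p^k]) : Sel^{(p^k)}] = [S_Σ[p^k] : Sel_{p^∞}[p^k]]` and, for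
# `k ≫ 0`, `[S_Σ[p^k] : Sel_{p^∞}[p^k]] · [Sel^{(p^k)} : H¹_{𝓚⊓ur@Σ}(K,E[p^k])] = ∏_{v∈Σ} p^{v_p(c_v)}`
# (seat `bsd-cm-prr-ty1` g11, cell `bsd-cm`; theorems only: no definition, no named fact, no instance, no `sorry`)

Part 26 of the seat's kernel cut of stub 3 `stub_rankOneCountReadingKato` of the Kato–Perrin-Riou skeletons v4 (cruxes
stmt-BirchSwinnertonDyer-19945 / -19223; = cell bsd-potss's held input 27322).  Parts 22–25 prove (R1-d) at finite level:
`[H¹_{𝓚⊔ur@Σ}(K, E[p^k]) : H¹_{𝓚⊓ur@Σ}(K, E[p^k])] = ∏_{v∈Σ} p^{v_p(c_v)}` for `k ≫ 0` (`Σ` additive places `∤ p`, `p` odd).  The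
potss memo's (R1-d) «`#(S(T)/Sel_{p^∞}) · p^a = C′`» lives on `E[p^∞]`; THIS FILE moves the RELAXED and the KUMMER Selmer groups
to `E[p^∞]` along the tree's `ι_k = H¹(Levels.primaryInclusion W p k)` (X11b `PrimaryInclusionLevels`):

* §1 `map_primaryInclusion_mem_selmerLocalKerPrimary_iff` — at every `K`-field `E` (completion): `ι_k y` dies in `H¹(E, E(K̄_E))`
  iff `y` does (functoriality of the pair `(Γ_E → Γ_K, E[p^k] ↪ E[p^∞] → E(K̄_E))`); hence
  **`comap_map_primaryInclusion_selmerGroupPInfty`: `ι_k⁻¹ Sel_{p^∞}(E/K) = Sel^{(p^k)}(E/K)`** (`= H¹_𝓚(K, E[p^k])`).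
* §2 `localization_mem_kummer_sup_unramified_iff` — at a finite `v ∤ p` whose inertia-fixed `p^∞`-torsion is killed by `p^k`
  (every additive `v ∤ p`, `p` odd: n1011 `inertia_torsion_of_hasAdditiveReductionAt`): `loc_v y ∈ 𝓚_v ⊔ H¹_ur(K_v, E[p^k])` iff
  `loc_v (ι_k y) ∈ H¹_ur(K_v, E[p^∞])` — n1011's door `ι_{k,v}⁻¹(H¹_ur(K_v, E[p^∞])) = H¹_ur(K_v, E[p^k]) ⊔ ker ι_{k,v}`
  (`comap_map_unramifiedSubgroup_eq_sup_ker_of_inertia_torsion`) with `ker ι_{k,v} = 𝓚_v` at `v ∤ p` (X11b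
  `LevelKummer.kummerLocalConditionAt_eq_ker_map_primaryInclusion`); hence
  **`selmerGroup_kummerSupUnramified_eq_comap`: `H¹_{𝓚⊔ur@Σ}(K, E[p^k]) = ι_k⁻¹ S_Σ`** for ANY subgroup `S_Σ ≤ H¹(K, E[p^∞])`
  cut out by «`p^∞`-Selmer local kernel at every place off `Σ`, unramified at `Σ`» (hypothesis-form binder `hS`; over `ℚ`
  with `Σ` = the bad primes `≠ p` this is Kato's `S(T)`, as `H¹_ur(ℚ_ℓ, E[p^∞]) = 0 = 𝓚_ℓ^∞` at good `ℓ ≠ p`).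
* §3 **`relIndex_selmerGroup_kummer_eq_relIndex_selmerGroupPInfty`** — `[H¹_{𝓚⊔ur@Σ}(K, E[p^k]) : Sel^{(p^k)}(E/K)] =
  [S_Σ ⊓ im ι_k : Sel_{p^∞} ⊓ (S_Σ ⊓ im ι_k)]` (`AddSubgroup.relIndex_comap`; no injectivity needed), with `im ι_k =
  H¹(K, E[p^∞])[p^k]` (X11b `mem_range_map_primaryInclusion_iff`, divisibility of `E(K̄)` from `zsmul_geomPoints_surjective_holds`);
  `map_primaryInclusion_injective_of_no_pTorsion` — `ι_k` is injective when `E(K)[p] = 0` (so `H¹_𝓖 ≅ S_Σ[p^k]` as groups).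
* §4 **`exists_forall_le_relIndex_selmerGroupPInfty_mul_relIndex_eq`** (`K : Type`, `p` odd, `Σ` additive `∤ p`) — with Part 25:
  `∃ k₀ ≥ 1, ∀ k ≥ k₀: [S_Σ ⊓ im ι_k : Sel_{p^∞} ⊓ (S_Σ ⊓ im ι_k)] · [Sel^{(p^k)} : H¹_{𝓚⊓ur@Σ}(K, E[p^k])] = ∏_{v∈Σ} p^{v_p(c_v)}`.
  The second factor is the level-`p^k` avatar of `p^a = [ℤ_pκ_∞(P) : 𝔥]` (Parts 19–21); its stabilisation and identification
  with `p^a` (the COMPACT side) is NOT done here.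

HONEST LABEL: theorems only; no stub or item is closed; nothing is registered; nothing is asserted on 19945 / 19223;
Kato's Main Conjecture and Perrin-Riou's conjecture are not touched; BSD is not proved for any curve.

References: [Rubin2000] Thm. 1.7.3; [Kato2004Asterisque] §14.8 (p. 238), (14.9.3) (p. 240); [GreenbergLNM1716] §2 (p. 63), §5
proof of Prop. 5.8 (p. 114); [MilneADT2006] Ch. I §6, Thm. 4.10; [SilvermanAEC2009] VIII.§2, X.§4.
-/

noncomputable section

open scoped Classical ContRepresentation NumberField
open Function Field NumberField IsDedekindDomain WeierstrassCurve
open Literature.NumberTheory.EllipticCurves Literature.NumberTheory.GaloisRepresentations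
  Literature.NumberTheory.GaloisRepresentations.DiscreteGaloisModule Literature.NumberTheory.GaloisCohomology
open Summit.BirchSwinnertonDyer.Rank1Residual.X11b.Levels Summit.BirchSwinnertonDyer.Rank1Residual.X11b.LocBridge
open Summit.BirchSwinnertonDyer.Rank1Residual.GaloisImage

universe u

namespace Summit.BirchSwinnertonDyer.Rank1Residual.Additive.KummerUnramified

/-! ## §1 `ι_k` and the local kernels; `ι_k⁻¹ Sel_{p^∞} = Sel^{(p^k)}` -/

section LocalKernels

variable {K : Type u} [Field K] [NumberField K] (W : WeierstrassCurve K) (p k : ℕ)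

omit [NumberField K] in
/-- `ι_k = H¹(E[p^k] ↪ E[p^∞])` as the tree's `resH1Hom` of the compatible pair `(id, E[p^k] ↪ E[p^∞])` (definitional). [folklore] -/
theorem map_primaryInclusion_eq_resH1Hom :
    (galoisCohomology.map (primaryInclusion W p k) 1 :
        galH1Torsion W ((p ^ k : ℕ) : ℤ) →+ W.galH1Primary p) =
      resH1Hom (ContinuousMonoidHom.id (absoluteGaloisGroup K))
        (AddSubgroup.inclusion (geomTorsion_pow_le_geomPrimaryTorsion W p k)) (fun _ _ ↦ rfl) :=
  rfl

omit [NumberField K] in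
/-- **`ι_k` respects the local kernels**: for every `K`-field `E`, `ι_k y` dies in `H¹(E, E(K̄_E))` iff `y` does (both are the
map of the pair `(Γ_E → Γ_K, E[p^k] ↪ E(K̄) → E(K̄_E))`). [cite: GreenbergLNM1716, §5 proof of Prop. 5.8 (p. 114)] -/
theorem map_primaryInclusion_mem_selmerLocalKerPrimary_iff (E : Type u) [Field E] [Algebra K E]
    (y : galH1Torsion W ((p ^ k : ℕ) : ℤ)) :
    (galoisCohomology.map (primaryInclusion W p k) 1 : galH1Torsion W ((p ^ k : ℕ) : ℤ) →+ W.galH1Primary p) y ∈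
        selmerLocalKerPrimary W E p ↔
      y ∈ selmerLocalKer W E ((p ^ k : ℕ) : ℤ) := by
  refine (W.mem_selmerLocalKerPrimary_iff p _).trans ?_
  change resH1Hom (resGal (K := K) E) ((pointsMap W E).comp (geomPrimaryTorsion W p).subtype)
      (W.pointsMap_comp_subtype_smul p)
      (resH1Hom (ContinuousMonoidHom.id (absoluteGaloisGroup K))
        (AddSubgroup.inclusion (geomTorsion_pow_le_geomPrimaryTorsion W p k)) (fun _ _ ↦ rfl) y) = 0 ↔
    resH1Hom (resGal (K := K) E) ((pointsMap W E).comp (geomTorsion W ((p ^ k : ℕ) : ℤ)).subtype) _ y = 0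
  rw [resH1Hom_resH1Hom]
  exact Iff.of_eq (congrArg (· = 0)
    (DFunLike.congr_fun (resH1Hom_congr (by ext; rfl) (by ext; rfl) _ _) y))

/-- **`ι_k⁻¹ Sel_{p^∞}(E/K) = Sel^{(p^k)}(E/K)`.** [cite: GreenbergLNM1716, §5 proof of Prop. 5.8 (p. 114)] [cite: MilneADT2006, Ch. I §6] -/
theorem comap_map_primaryInclusion_selmerGroupPInfty :
    (selmerGroupPInfty W p).comap
        (galoisCohomology.map (primaryInclusion W p k) 1 : galH1Torsion W ((p ^ k : ℕ) : ℤ) →+ W.galH1Primary p) =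
      selmerGroup W ((p ^ k : ℕ) : ℤ) := by
  ext y
  refine Iff.trans ?_ (WeierstrassCurve.mem_selmerGroup_iff W _ y).symm
  change ((_ ∈ ⨅ v : HeightOneSpectrum (𝓞 K), selmerLocalKerPrimary W (v.adicCompletion K) p) ∧
      _ ∈ ⨅ w : InfinitePlace K, selmerLocalKerPrimary W w.Completion p) ↔ _
  rw [AddSubgroup.mem_iInf, AddSubgroup.mem_iInf]
  exact and_congr (forall_congr' fun v => map_primaryInclusion_mem_selmerLocalKerPrimary_iff W p k _ y)
    (forall_congr' fun w => map_primaryInclusion_mem_selmerLocalKerPrimary_iff W p k _ y)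

/-- The same for the Kummer Selmer structure: `H¹_𝓚(K, E[p^k]) = ι_k⁻¹ Sel_{p^∞}(E/K)`. [cite: MilneADT2006, Ch. I §6 (6.14)] -/
theorem selmerGroup_kummerSelmerStructure_eq_comap :
    (W.kummerSelmerStructure ((p ^ k : ℕ) : ℤ)).selmerGroup =
      (selmerGroupPInfty W p).comap
        (galoisCohomology.map (primaryInclusion W p k) 1 : galH1Torsion W ((p ^ k : ℕ) : ℤ) →+ W.galH1Primary p) := by
  rw [comap_map_primaryInclusion_selmerGroupPInfty, selmerGroup_eq_selmerGroup_kummerSelmerStructure]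

end LocalKernels

/-! ## §2 The relaxed structure: `H¹_{𝓚 ⊔ ur@Σ}(K, E[p^k]) = ι_k⁻¹ S_Σ` -/

section Relaxed

variable {K : Type u} [Field K] [NumberField K] (W : WeierstrassCurve K) [W.IsElliptic] (p k : ℕ) [hp : Fact p.Prime]

/-- **At a finite `v ∤ p` with `E(K_v^nr)[p^∞]` killed by `p^k`: `loc_v y ∈ 𝓚_v ⊔ H¹_ur(K_v, E[p^k])` iff
`loc_v (ι_k y) ∈ H¹_ur(K_v, E[p^∞])`** — n1011's door `ι_{k,v}⁻¹(H¹_ur) = H¹_ur ⊔ ker ι_{k,v}`, `ker ι_{k,v} = 𝓚_v` (X11b), and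
`loc_v ∘ ι_k = ι_{k,v} ∘ loc_v`. [cite: GreenbergLNM1716, §2 (pp. 72–74)] [cite: MilneADT2006, Ch. I, Prop. 3.8] -/
theorem localization_mem_kummer_sup_unramified_iff (v : HeightOneSpectrum (𝓞 K))
    (hpv : ((p : ℕ) : 𝓞 K) ∉ v.asIdeal)
    (hI : ∀ Q : W.geomPrimaryTorsion p,
      (∀ τ ∈ absInertia (v.adicCompletion K),
        GaloisRep.restrictField (v.adicCompletion K) (primaryGaloisModule W p) τ Q = Q) → p ^ k • Q = 0)
    (y : galH1Torsion W ((p ^ k : ℕ) : ℤ)) :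
    galoisCohomology.localization (W.torsionGaloisModule ((p ^ k : ℕ) : ℤ)) (Sum.inr v) 1 y ∈
        W.kummerSelmerStructure ((p ^ k : ℕ) : ℤ) (Sum.inr v) ⊔
          unramifiedSubgroup (GaloisRep.toLocal v (W.torsionGaloisModule ((p ^ k : ℕ) : ℤ))) 1 ↔
      galoisCohomology.localization (primaryGaloisModule W p) (Sum.inr v) 1
          (galoisCohomology.map (primaryInclusion W p k) 1 y) ∈
        unramifiedSubgroup (GaloisRep.toLocal v (primaryGaloisModule W p)) 1 := by
  have hn : ((p ^ k : ℕ) : ℤ) ≠ 0 := by exact_mod_cast pow_ne_zero k hp.out.ne_zero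
  have hdoor := comap_map_unramifiedSubgroup_eq_sup_ker_of_inertia_torsion
    (ρA := GaloisRep.restrictField (v.adicCompletion K) (W.torsionGaloisModule ((p ^ k : ℕ) : ℤ)))
    (ρB := GaloisRep.restrictField (v.adicCompletion K) (primaryGaloisModule W p))
    (exists_primaryInclusion_restrictField_eq_of_nsmul_eq_zero W p k (v.adicCompletion K))
    (primaryInclusion_restrictField_injective W p k (v.adicCompletion K))
    (pow_nsmul_geomTorsion_eq_zero W p k) hI
  have hker : (galoisCohomology.map ((primaryInclusion W p k).restrictField (v.adicCompletion K)) 1).ker =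
      W.kummerSelmerStructure ((p ^ k : ℕ) : ℤ) (Sum.inr v) :=
    (X11b.LevelKummer.kummerLocalConditionAt_eq_ker_map_primaryInclusion W p k v hpv hn).symm
  rw [localization_map_one', ← AddSubgroup.mem_comap]
  change _ ↔ _ ∈ (DiscreteGaloisModule.unramifiedSubgroup
    (GaloisRep.restrictField (v.adicCompletion K) (primaryGaloisModule W p)) 1).comap
      (galoisCohomology.map ((primaryInclusion W p k).restrictField (v.adicCompletion K)) 1)
  rw [hdoor, hker, sup_comm]
  rfl

/-- **`H¹_{𝓚 ⊔ ur@Σ}(K, E[p^k]) = ι_k⁻¹ S_Σ`.**  Here `𝓖` is any Selmer structure on `E[p^k]` with `𝓖_v = 𝓚_v ⊔ H¹_ur(K_v, E[p^k])` at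
`v ∈ Σ` and `𝓖_v = 𝓚_v` at EVERY other place (infinite ones included), `Σ` a finite set of finite `v ∤ p` whose inertia-fixed
`p^∞`-torsion is killed by `p^k` (binder `hI`), and `S_Σ ≤ H¹(K, E[p^∞])` ANY subgroup cut out by «the `p^∞`-Selmer local kernel at
every place off `Σ`, unramified at `Σ`» (binder `hS`; Kato's `S(T)` when `Σ` = the bad places `∤ p`).
[cite: Kato2004Asterisque, §14.8 (p. 238)] [cite: GreenbergLNM1716, §5 proof of Prop. 5.8 (p. 114)] -/
theorem selmerGroup_kummerSupUnramified_eq_comap (Q : Finset (HeightOneSpectrum (𝓞 K)))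
    (hQp : ∀ v ∈ Q, ((p : ℕ) : 𝓞 K) ∉ v.asIdeal)
    (hI : ∀ v ∈ Q, ∀ X : W.geomPrimaryTorsion p,
      (∀ τ ∈ absInertia (v.adicCompletion K),
        GaloisRep.restrictField (v.adicCompletion K) (primaryGaloisModule W p) τ X = X) → p ^ k • X = 0)
    (𝓖 : SelmerStructure (W.torsionGaloisModule ((p ^ k : ℕ) : ℤ)))
    (h𝓖Q : ∀ v ∈ Q, 𝓖 (Sum.inr v) = W.kummerSelmerStructure ((p ^ k : ℕ) : ℤ) (Sum.inr v) ⊔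
      unramifiedSubgroup (GaloisRep.toLocal v (W.torsionGaloisModule ((p ^ k : ℕ) : ℤ))) 1)
    (h𝓖nQ : ∀ v ∉ Q, 𝓖 (Sum.inr v) = W.kummerSelmerStructure ((p ^ k : ℕ) : ℤ) (Sum.inr v))
    (h𝓖inl : ∀ w : InfinitePlace K, 𝓖 (Sum.inl w) = W.kummerSelmerStructure ((p ^ k : ℕ) : ℤ) (Sum.inl w))
    (S : AddSubgroup (W.galH1Primary p))
    (hS : ∀ x, x ∈ S ↔
      (∀ v : HeightOneSpectrum (𝓞 K), v ∉ Q → x ∈ selmerLocalKerPrimary W (v.adicCompletion K) p) ∧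
      (∀ w : InfinitePlace K, x ∈ selmerLocalKerPrimary W w.Completion p) ∧
      (∀ v ∈ Q, galoisCohomology.localization (primaryGaloisModule W p) (Sum.inr v) 1 x ∈
        unramifiedSubgroup (GaloisRep.toLocal v (primaryGaloisModule W p)) 1)) :
    𝓖.selmerGroup = S.comap
      (galoisCohomology.map (primaryInclusion W p k) 1 : galH1Torsion W ((p ^ k : ℕ) : ℤ) →+ W.galH1Primary p) := by
  ext y
  refine ((SelmerStructure.mem_selmerGroup_iff 𝓖 y).trans ?_).trans (hS _).symm
  -- the Kummer condition at a place, read on `ι_k y`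
  have hkum : ∀ u : Place K,
      galoisCohomology.localization (W.torsionGaloisModule ((p ^ k : ℕ) : ℤ)) u 1 y ∈
          W.kummerSelmerStructure ((p ^ k : ℕ) : ℤ) u ↔
        (galoisCohomology.map (primaryInclusion W p k) 1 : galH1Torsion W ((p ^ k : ℕ) : ℤ) →+ W.galH1Primary p) y ∈
          selmerLocalKerPrimary W (Place.Completion u) p := by
    intro u
    rw [map_primaryInclusion_mem_selmerLocalKerPrimary_iff]
    -- `loc_u y ∈ 𝓚_u ↔ y ∈ (𝓚_u).comap loc_u = selmerLocalKer W (K_u) (p^k)`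
    exact (SetLike.ext_iff.mp (W.comap_localization_kummerSelmerStructure ((p ^ k : ℕ) : ℤ) u) y)
  constructor
  · intro h
    refine ⟨fun v hv => ?_, fun w => ?_, fun v hv => ?_⟩
    · have h' := h (Sum.inr v); rw [h𝓖nQ v hv, hkum] at h'; exact h'
    · have h' := h (Sum.inl w); rw [h𝓖inl w, hkum] at h'; exact h'
    · have h' := h (Sum.inr v); rw [h𝓖Q v hv] at h'
      exact (localization_mem_kummer_sup_unramified_iff W p k v (hQp v hv) (hI v hv) y).1 h'
  · rintro ⟨hfin, hinf, hQ⟩ u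
    rcases u with w | v
    · rw [h𝓖inl w, hkum]; exact hinf w
    · by_cases hv : v ∈ Q
      · rw [h𝓖Q v hv]
        exact (localization_mem_kummer_sup_unramified_iff W p k v (hQp v hv) (hI v hv) y).2 (hQ v hv)
      · rw [h𝓖nQ v hv, hkum]; exact hfin v hv

end Relaxed

/-! ## §3 The relaxation index moved to `E[p^∞]` -/

section Index

variable {K : Type u} [Field K] [NumberField K] (W : WeierstrassCurve K) [W.IsElliptic] (p k : ℕ) [hp : Fact p.Prime]

omit [NumberField K] in
/-- **The image of `ι_k` is the `p^k`-torsion of `H¹(K, E[p^∞])`** (X11b, with the divisibility of `E(K̄)` discharged).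
[cite: GreenbergLNM1716, §5 proof of Prop. 5.8 (p. 114)] -/
theorem mem_range_map_primaryInclusion_iff' (x : W.galH1Primary p) :
    x ∈ (galoisCohomology.map (primaryInclusion W p k) 1 : galH1Torsion W ((p ^ k : ℕ) : ℤ) →+ W.galH1Primary p).range ↔
      p ^ k • x = 0 :=
  mem_range_map_primaryInclusion_iff W p k W.zsmul_geomPoints_surjective_holds x

omit [W.IsElliptic] hp in
/-- **`ι_k` is injective when `E(K)` has no point of order `p`.** [cite: GreenbergLNM1716, §2 (p. 63)] -/
theorem map_primaryInclusion_injective_of_no_pTorsion (hK : ∀ P : W.toAffine.Point, p • P = 0 → P = 0) :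
    Function.Injective (galoisCohomology.map (primaryInclusion W p k) 1 : galH1Torsion W ((p ^ k : ℕ) : ℤ) →+ W.galH1Primary p) :=
  map_primaryInclusion_injective W p k fun _ hX => W.eq_zero_of_forall_smul_eq hK fun σ => hX σ

omit [NumberField K] hp [W.IsElliptic] in
/-- **`ι_k(ι_k⁻¹ S_Σ) = S_Σ ⊓ im ι_k`.** [folklore] -/
theorem map_comap_eq_inf_range (S : AddSubgroup (W.galH1Primary p)) :
    (S.comap (galoisCohomology.map (primaryInclusion W p k) 1 : galH1Torsion W ((p ^ k : ℕ) : ℤ) →+ W.galH1Primary p)).map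
        (galoisCohomology.map (primaryInclusion W p k) 1 : galH1Torsion W ((p ^ k : ℕ) : ℤ) →+ W.galH1Primary p) =
      S ⊓ (galoisCohomology.map (primaryInclusion W p k) 1 : galH1Torsion W ((p ^ k : ℕ) : ℤ) →+ W.galH1Primary p).range :=
  (AddSubgroup.map_comap_eq _ _).trans (inf_comm _ _)

omit [W.IsElliptic] hp in
/-- **`[H¹_𝓖(K, E[p^k]) : Sel^{(p^k)}(E/K)] = [S_Σ ⊓ im ι_k : Sel_{p^∞} ⊓ (S_Σ ⊓ im ι_k)]`** — the relaxation index moved to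
`E[p^∞]` along `ι_k` (`Sel^{(p^k)} = ι_k⁻¹ Sel_{p^∞}`, `ι_k(H¹_𝓖) = S_Σ ⊓ im ι_k`; no injectivity needed).
[cite: GreenbergLNM1716, §5 proof of Prop. 5.8 (p. 114)] [cite: Kato2004Asterisque, §14.8 (p. 238)] -/
theorem relIndex_selmerGroup_kummer_eq_relIndex_selmerGroupPInfty
    (𝓖 : SelmerStructure (W.torsionGaloisModule ((p ^ k : ℕ) : ℤ))) (S : AddSubgroup (W.galH1Primary p))
    (h𝓖 : 𝓖.selmerGroup = S.comap (galoisCohomology.map (primaryInclusion W p k) 1 : galH1Torsion W ((p ^ k : ℕ) : ℤ) →+ W.galH1Primary p)) :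
    (W.kummerSelmerStructure ((p ^ k : ℕ) : ℤ)).selmerGroup.relIndex 𝓖.selmerGroup =
      (selmerGroupPInfty W p).relIndex
        (S ⊓ (galoisCohomology.map (primaryInclusion W p k) 1 : galH1Torsion W ((p ^ k : ℕ) : ℤ) →+ W.galH1Primary p).range) := by
  rw [selmerGroup_kummerSelmerStructure_eq_comap, h𝓖, AddSubgroup.relIndex_comap]
  exact congrArg _ ((AddSubgroup.map_comap_eq _ _).trans (inf_comm _ _))

end Index

/-! ## §4 With Part 25: `[S_Σ ⊓ im ι_k : Sel_{p^∞} ⊓ …] · [Sel^{(p^k)} : H¹_{𝓚⊓ur@Σ}] = ∏_{v∈Σ} p^{v_p(c_v)}` for `k ≫ 0` -/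

section Assembly

variable {K : Type} [Field K] [NumberField K] (W : WeierstrassCurve K) [W.IsElliptic] (p : ℕ) [hp : Fact p.Prime]

/-- **(R1-d), discrete side moved to `E[p^∞]`**: for an elliptic curve over a number field `K : Type`, `p` odd, finite sets
`Σ ⊆ T` of finite places (every `v ∈ Σ` ADDITIVE with `v ∤ p`; `T ⊇ {v ∣ p} ∪ {bad}`), and ANY subgroup `S_Σ ≤ H¹(K, E[p^∞])`
cut out by «`p^∞`-Selmer local kernel off `Σ`, unramified at `Σ`» (binder `hS`): `∃ k₀ ≥ 1, ∀ k ≥ k₀`, for all Selmer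
structures `𝓖` («`𝓚 ⊔ H¹_ur` at `Σ`, `𝓚` at every other place») and `𝓖'` («`𝓚 ⊓ H¹_ur` at `Σ`, `𝓚` at every other place») on
`E[p^k]`: `H¹_𝓖 = ι_k⁻¹ S_Σ`, and
`[S_Σ ⊓ im ι_k : Sel_{p^∞} ⊓ (S_Σ ⊓ im ι_k)] · [Sel^{(p^k)}(E/K) : H¹_{𝓖'}(K, E[p^k])] = ∏_{v∈Σ} p^{v_p(c_v)}`.
[cite: Rubin2000, Thm. 1.7.3] [cite: Kato2004Asterisque, §14.8 (p. 238) and (14.9.3) (p. 240)] [cite: GreenbergLNM1716, §5 (p. 114)] -/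
theorem exists_forall_le_relIndex_selmerGroupPInfty_mul_relIndex_eq (hodd : p ≠ 2)
    (Q T : Finset (HeightOneSpectrum (𝓞 K))) (hQT : Q ⊆ T)
    (hQp : ∀ v ∈ Q, ((p : ℕ) : 𝓞 K) ∉ v.asIdeal) (hQadd : ∀ v ∈ Q, W.HasAdditiveReductionAt v)
    (hTp : ∀ v : HeightOneSpectrum (𝓞 K), ((p : ℕ) : 𝓞 K) ∈ v.asIdeal → v ∈ T)
    (hTbad : ∀ v : HeightOneSpectrum (𝓞 K), ¬ W.HasGoodReductionAt v → v ∈ T)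
    (S : AddSubgroup (W.galH1Primary p))
    (hS : ∀ x, x ∈ S ↔
      (∀ v : HeightOneSpectrum (𝓞 K), v ∉ Q → x ∈ selmerLocalKerPrimary W (v.adicCompletion K) p) ∧
      (∀ w : InfinitePlace K, x ∈ selmerLocalKerPrimary W w.Completion p) ∧
      (∀ v ∈ Q, galoisCohomology.localization (primaryGaloisModule W p) (Sum.inr v) 1 x ∈
        unramifiedSubgroup (GaloisRep.toLocal v (primaryGaloisModule W p)) 1)) :
    ∃ k₀ : ℕ, 1 ≤ k₀ ∧ ∀ k, k₀ ≤ k →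
      ∀ (𝓖 𝓖' : SelmerStructure (W.torsionGaloisModule ((p ^ k : ℕ) : ℤ))),
        (∀ v ∈ Q, 𝓖 (Sum.inr v) = W.kummerSelmerStructure ((p ^ k : ℕ) : ℤ) (Sum.inr v) ⊔
          unramifiedSubgroup (GaloisRep.toLocal v (W.torsionGaloisModule ((p ^ k : ℕ) : ℤ))) 1) →
        (∀ v ∉ Q, 𝓖 (Sum.inr v) = W.kummerSelmerStructure ((p ^ k : ℕ) : ℤ) (Sum.inr v)) →
        (∀ w : InfinitePlace K, 𝓖 (Sum.inl w) = W.kummerSelmerStructure ((p ^ k : ℕ) : ℤ) (Sum.inl w)) →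
        (∀ v ∈ Q, 𝓖' (Sum.inr v) = W.kummerSelmerStructure ((p ^ k : ℕ) : ℤ) (Sum.inr v) ⊓
          unramifiedSubgroup (GaloisRep.toLocal v (W.torsionGaloisModule ((p ^ k : ℕ) : ℤ))) 1) →
        (∀ v ∉ Q, 𝓖' (Sum.inr v) = W.kummerSelmerStructure ((p ^ k : ℕ) : ℤ) (Sum.inr v)) →
        (∀ w : InfinitePlace K, 𝓖' (Sum.inl w) = W.kummerSelmerStructure ((p ^ k : ℕ) : ℤ) (Sum.inl w)) →
        𝓖.selmerGroup = S.comap (galoisCohomology.map (primaryInclusion W p k) 1 : galH1Torsion W ((p ^ k : ℕ) : ℤ) →+ W.galH1Primary p) ∧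
        (selmerGroupPInfty W p).relIndex
              (S ⊓ (galoisCohomology.map (primaryInclusion W p k) 1 : galH1Torsion W ((p ^ k : ℕ) : ℤ) →+ W.galH1Primary p).range) *
            𝓖'.selmerGroup.relIndex (W.kummerSelmerStructure ((p ^ k : ℕ) : ℤ)).selmerGroup =
          ∏ v ∈ Q, p ^ padicValNat p
            ((W.baseChange (v.adicCompletion K)).localTamagawaNumber (v.adicCompletionIntegers K)) := by
  obtain ⟨k₀, hk₀, h⟩ := exists_forall_le_relIndex_selmerGroup_eq_prod_pow_padicValNat_localTamagawaNumber W p hodd Q T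
    hQT hQp hQadd hTp hTbad
  refine ⟨k₀, hk₀, fun k hk 𝓖 𝓖' h𝓖Q h𝓖nQ h𝓖inl h𝓖'Q h𝓖'nQ h𝓖'inl => ?_⟩
  have hk1 : 1 ≤ k := le_trans hk₀ hk
  -- the inertia-torsion binder at the additive places of `Q`
  have hI : ∀ v ∈ Q, ∀ X : W.geomPrimaryTorsion p,
      (∀ τ ∈ absInertia (v.adicCompletion K),
        GaloisRep.restrictField (v.adicCompletion K) (primaryGaloisModule W p) τ X = X) → p ^ k • X = 0 :=
    fun v hv X hX => by
      rw [← Nat.sub_add_cancel hk1, pow_succ, mul_smul,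
        inertia_torsion_of_hasAdditiveReductionAt W p v (hQp v hv) hodd (hQadd v hv) X hX, smul_zero]
  have hcomap := selmerGroup_kummerSupUnramified_eq_comap W p k Q hQp hI 𝓖 h𝓖Q h𝓖nQ h𝓖inl S hS
  refine ⟨hcomap, ?_⟩
  obtain ⟨hle', hidx⟩ := h k hk 𝓖 𝓖' h𝓖Q h𝓖nQ h𝓖'Q h𝓖'nQ (fun w => by rw [h𝓖inl w, h𝓖'inl w])
  -- `H¹_{𝓖'} ≤ H¹_𝓚 ≤ H¹_𝓖`
  have hle₁ : 𝓖'.selmerGroup ≤ (W.kummerSelmerStructure ((p ^ k : ℕ) : ℤ)).selmerGroup := fun x hx => by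
    rw [SelmerStructure.mem_selmerGroup_iff] at hx ⊢
    intro u
    rcases u with w | v
    · rw [← h𝓖'inl w]; exact hx _
    · by_cases hv : v ∈ Q
      · have h' := hx (Sum.inr v); rw [h𝓖'Q v hv] at h'; exact h'.1
      · rw [← h𝓖'nQ v hv]; exact hx _
  have hle₂ : (W.kummerSelmerStructure ((p ^ k : ℕ) : ℤ)).selmerGroup ≤ 𝓖.selmerGroup := fun x hx => by
    rw [SelmerStructure.mem_selmerGroup_iff] at hx ⊢
    intro u
    rcases u with w | v
    · rw [h𝓖inl w]; exact hx _
    · by_cases hv : v ∈ Q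
      · rw [h𝓖Q v hv]; exact AddSubgroup.mem_sup_left (hx _)
      · rw [h𝓖nQ v hv]; exact hx _
  rw [← relIndex_selmerGroup_kummer_eq_relIndex_selmerGroupPInfty W p k 𝓖 S hcomap, mul_comm,
    AddSubgroup.relIndex_mul_relIndex _ _ _ hle₁ hle₂]
  exact hidx

end Assembly

end Summit.BirchSwinnertonDyer.Rank1Residual.Additive.KummerUnramified

end
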